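import Summits.MatrixMultiplication.MatrixMultiplication.Theorems.SoloInformedConverseDoorFormats
import HarnessLib

/-!
# The converse door for the whole Coppersmith–Winograd family, every field, every level

Solo seat `solo-MatrixMultiplication-informed` (generation 28).  Coppersmith–Winograd's door is a
family: `ω ≤ log_q((4/27)·R̃(T_{cw,q})³)` (CGLV Thm 1.2; Thm 2.5 for the skew cousins
`T_{skewcw,q}`, `q = 2u`), so minimal asymptotic rank `q + 1` would give `ω = 2` at `q = 2` and
`ω < 2.05` at `q = 3`.  The converse mechanism — a flattening-tight embedding
`⟨m,m,m⟩ ⊵ T^{⊠N}`, `m² = (q+1)^N` — is excluded here for the WHOLE family over EVERY field at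
EVERY level: the little Coppersmith–Winograd tensor `cwTensor K q`
(`q ≥ 2`) and the skew one `skewCwTensor K u` (`u ≥ 1`) are door-like (`doorLike_cwTensor`,
`doorLike_skewCwTensor`, proved from the defining support conditions, not by `decide`) with
third-leg data, so the door-like support theorem and the format theorem of the preceding files
apply: `not_matMul_polyDegeneratesTo_cw_pow`, `converseDoor_formats_cw` (`(q+1)^N ≤ kn, km, mn`
and `(q+1)^{3N} < (kmn)²` whenever `⟨k,m,n⟩ ⊵ T_{cw,q}^{⊠N}`, `N ≥ 1`), and the same for
`T_{skewcw,2u}` (`…_skewCw_pow`, `converseDoor_formats_skewCw`).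

## References
* A. Conner, F. Gesmundo, J. M. Landsberg, E. Ventura, *Rank and border rank of Kronecker powers
  of tensors and Strassen's laser method*, comput. complexity 31 (2022), arXiv:1909.04785, eq. (1),
  eq. (3), Thm 1.2, Thm 2.5. [ConnerGesmundoLandsbergVentura2022]
* D. Coppersmith, S. Winograd, *Matrix multiplication via arithmetic progressions*, J. Symbolic
  Comput. 9 (1990), §11. [CoppersmithWinograd1990]
-/

open scoped BigOperators

namespace Summit.MatrixMultiplication.MatrixMultiplication.Theorems

open Matrix Finset Module
open Literature.Computability.AlgebraicComplexity Literature.Barriers.MatrixMultiplication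

universe u

set_option linter.unusedSectionVars false

namespace ConverseDoorCwFamily

open OrbitRankGen ConverseDoorAll FlatDegen ConverseDoorFormats

variable {F : Type u} [Field F]

/-! ## The support of `T_{cw,q}` -/

/-- The support of `T_{cw,q}` in coordinates. [cite: ConnerGesmundoLandsbergVentura2022, eq. (1)] -/
theorem cw_ne_zero_iff (q : ℕ) (i j k : Fin (q + 1)) :
    cwTensor F q i j k ≠ 0 ↔
      ((i : ℕ) = 0 ∧ (j : ℕ) = k ∧ (j : ℕ) ≠ 0) ∨ ((j : ℕ) = 0 ∧ (i : ℕ) = k ∧ (i : ℕ) ≠ 0) ∨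
        ((k : ℕ) = 0 ∧ (i : ℕ) = j ∧ (i : ℕ) ≠ 0) := by
  have h0 : ((0 : Fin (q + 1)) : ℕ) = 0 := rfl
  rw [cwTensor_apply]
  split_ifs with h
  · simp only [Fin.ext_iff, h0] at h
    exact iff_of_true one_ne_zero (by omega)
  · simp only [Fin.ext_iff, h0] at h
    exact iff_of_false (not_not.2 rfl) (by omega)

/-- The complement of the support of `T_{cw,q}`.
[cite: ConnerGesmundoLandsbergVentura2022, eq. (1)] -/
theorem cw_eq_zero_iff (q : ℕ) (i j k : Fin (q + 1)) :
    cwTensor F q i j k = 0 ↔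
      ¬ (((i : ℕ) = 0 ∧ (j : ℕ) = k ∧ (j : ℕ) ≠ 0) ∨ ((j : ℕ) = 0 ∧ (i : ℕ) = k ∧ (i : ℕ) ≠ 0) ∨
        ((k : ℕ) = 0 ∧ (i : ℕ) = j ∧ (i : ℕ) ≠ 0)) := by
  rw [← cw_ne_zero_iff (F := F), not_not]

/-- **`T_{cw,q}` is door-like for every `q ≥ 2`** (for `q = 1` condition (k₁) fails).
[cite: ConnerGesmundoLandsbergVentura2022, §3.2] -/
noncomputable def doorLike_cwTensor (q : ℕ) (hq : 2 ≤ q) : DoorLike (cwTensor F q) := by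
  have h0 : ((0 : Fin (q + 1)) : ℕ) = 0 := rfl
  let e₁ : Fin (q + 1) := ⟨1, by omega⟩
  let e₂ : Fin (q + 1) := ⟨2, by omega⟩
  have he₁ : (e₁ : ℕ) = 1 := rfl
  have he₂ : (e₂ : ℕ) = 2 := rfl
  refine ⟨fun b c i i' hi hi' => ?_, fun a c j j' hj hj' => ?_, fun a a' hne => ?_,
    fun b b' hne => ?_, fun a a' => ?_, fun b => ?_⟩
  · rw [cw_ne_zero_iff] at hi hi'
    exact Fin.ext (by omega)
  · rw [cw_ne_zero_iff] at hj hj'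
    exact Fin.ext (by omega)
  · -- (k₁): a witness column `(b, c)` of row `a'` on which row `a` vanishes
    have hne' : (a : ℕ) ≠ a' := fun h => hne (Fin.ext h)
    by_cases ha' : (a' : ℕ) = 0
    · by_cases ha1 : (a : ℕ) = 1
      · refine ⟨e₂, e₂, ?_, fun i => ?_⟩
        · rw [cw_ne_zero_iff]; omega
        · rw [cw_eq_zero_iff]; omega
      · refine ⟨e₁, e₁, ?_, fun i => ?_⟩
        · rw [cw_ne_zero_iff]; omega
        · rw [cw_eq_zero_iff]; omega
    · by_cases ha : (a : ℕ) = 0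
      · refine ⟨a', 0, ?_, fun i => ?_⟩
        · rw [cw_ne_zero_iff]; omega
        · rw [cw_eq_zero_iff]; omega
      · refine ⟨0, a', ?_, fun i => ?_⟩
        · rw [cw_ne_zero_iff]; omega
        · rw [cw_eq_zero_iff]; omega
  · -- (k₂): the same with the first two legs exchanged (`T_{cw,q}` is symmetric in them)
    have hne' : (b : ℕ) ≠ b' := fun h => hne (Fin.ext h)
    by_cases hb' : (b' : ℕ) = 0
    · by_cases hb1 : (b : ℕ) = 1
      · refine ⟨e₂, e₂, ?_, fun i => ?_⟩
        · rw [cw_ne_zero_iff]; omega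
        · rw [cw_eq_zero_iff]; omega
      · refine ⟨e₁, e₁, ?_, fun i => ?_⟩
        · rw [cw_ne_zero_iff]; omega
        · rw [cw_eq_zero_iff]; omega
    · by_cases hb : (b : ℕ) = 0
      · refine ⟨b', 0, ?_, fun i => ?_⟩
        · rw [cw_ne_zero_iff]; omega
        · rw [cw_eq_zero_iff]; omega
      · refine ⟨0, b', ?_, fun i => ?_⟩
        · rw [cw_ne_zero_iff]; omega
        · rw [cw_eq_zero_iff]; omega
  · -- (ℓ₁): rows `a`, `a'` share a column index `b`
    by_cases ha : (a : ℕ) = 0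
    · by_cases ha' : (a' : ℕ) = 0
      · refine ⟨e₁, e₁, e₁, ?_, ?_⟩ <;> rw [cw_ne_zero_iff] <;> omega
      · refine ⟨a', a', 0, ?_, ?_⟩ <;> rw [cw_ne_zero_iff] <;> omega
    · by_cases ha' : (a' : ℕ) = 0
      · refine ⟨a, 0, a, ?_, ?_⟩ <;> rw [cw_ne_zero_iff] <;> omega
      · refine ⟨0, a, a', ?_, ?_⟩ <;> rw [cw_ne_zero_iff] <;> omega
  · -- (ℓ₂): every `b` occurs
    by_cases hb : (b : ℕ) = 0
    · exact ⟨e₁, e₁, by rw [cw_ne_zero_iff]; omega⟩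
    · exact ⟨0, b, by rw [cw_ne_zero_iff]; omega⟩

/-- `T_{cw,q}` has third-leg data for every `q ≥ 1`.
[cite: ConnerGesmundoLandsbergVentura2022, §3.2] -/
noncomputable def thirdLeg_cwTensor (q : ℕ) (hq : 1 ≤ q) : ThirdLeg (cwTensor F q) := by
  have h0 : ((0 : Fin (q + 1)) : ℕ) = 0 := rfl
  let e₁ : Fin (q + 1) := ⟨1, by omega⟩
  have he₁ : (e₁ : ℕ) = 1 := rfl
  refine ⟨fun c => ?_, fun a b k k' hk hk' => ?_⟩
  · by_cases hc : (c : ℕ) = 0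
    · exact ⟨e₁, e₁, by rw [cw_ne_zero_iff]; omega⟩
    · exact ⟨0, c, by rw [cw_ne_zero_iff]; omega⟩
  · rw [cw_ne_zero_iff] at hk hk'
    exact Fin.ext (by omega)

/-! ## The support of `T_{skewcw,2u}` -/

/-- The support of `T_{skewcw,2u}` in coordinates (entries `0, ±1`, so the support is the same in
every field). [cite: ConnerGesmundoLandsbergVentura2022, eq. (3)] -/
theorem skew_ne_zero_iff (w : ℕ) (i j k : Fin (2 * w + 1)) :
    skewCwTensor F w i j k ≠ 0 ↔
      ((i : ℕ) = 0 ∧ (j : ℕ) = k ∧ (j : ℕ) ≠ 0) ∨ ((j : ℕ) = 0 ∧ (i : ℕ) = k ∧ (i : ℕ) ≠ 0) ∨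
        ((k : ℕ) = 0 ∧ 1 ≤ (i : ℕ) ∧ (i : ℕ) ≤ w ∧ (j : ℕ) = i + w) ∨
          ((k : ℕ) = 0 ∧ 1 ≤ (j : ℕ) ∧ (j : ℕ) ≤ w ∧ (i : ℕ) = j + w) := by
  have h0 : ((0 : Fin (2 * w + 1)) : ℕ) = 0 := rfl
  unfold skewCwTensor
  split_ifs with h1 h2 h3
  · simp only [Fin.ext_iff, h0] at h1
    exact iff_of_true one_ne_zero (by omega)
  · simp only [Fin.ext_iff, h0] at h1 h2
    exact iff_of_true one_ne_zero (by omega)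
  · simp only [Fin.ext_iff, h0] at h1 h2 h3
    exact iff_of_true (neg_ne_zero.2 one_ne_zero) (by omega)
  · simp only [Fin.ext_iff, h0] at h1 h2 h3
    exact iff_of_false (not_not.2 rfl) (by omega)

/-- The complement of the support of `T_{skewcw,2u}`.
[cite: ConnerGesmundoLandsbergVentura2022, eq. (3)] -/
theorem skew_eq_zero_iff (w : ℕ) (i j k : Fin (2 * w + 1)) :
    skewCwTensor F w i j k = 0 ↔
      ¬ (((i : ℕ) = 0 ∧ (j : ℕ) = k ∧ (j : ℕ) ≠ 0) ∨ ((j : ℕ) = 0 ∧ (i : ℕ) = k ∧ (i : ℕ) ≠ 0) ∨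
        ((k : ℕ) = 0 ∧ 1 ≤ (i : ℕ) ∧ (i : ℕ) ≤ w ∧ (j : ℕ) = i + w) ∨
          ((k : ℕ) = 0 ∧ 1 ≤ (j : ℕ) ∧ (j : ℕ) ≤ w ∧ (i : ℕ) = j + w)) := by
  rw [← skew_ne_zero_iff (F := F), not_not]

/-- An index of `Fin (2u+1)` with prescribed value. [folklore] -/
theorem exists_fin_val' {w v : ℕ} (hv : v ≤ 2 * w) : ∃ j : Fin (2 * w + 1), (j : ℕ) = v :=
  ⟨⟨v, by omega⟩, rfl⟩

/-- The skew partner `ξ ↦ ξ + u`, `ξ + u ↦ ξ` of a non-zero index: `T(a, p(a), 0) ≠ 0`.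
[cite: ConnerGesmundoLandsbergVentura2022, eq. (3)] -/
theorem exists_skewPartner (w : ℕ) (a : Fin (2 * w + 1)) (ha : (a : ℕ) ≠ 0) :
    ∃ p : Fin (2 * w + 1), (p : ℕ) ≠ 0 ∧ skewCwTensor F w a p 0 ≠ 0 ∧
      skewCwTensor F w p a 0 ≠ 0 := by
  have h0 : ((0 : Fin (2 * w + 1)) : ℕ) = 0 := rfl
  have halt := a.isLt
  by_cases hle : (a : ℕ) ≤ w
  · obtain ⟨p, hp⟩ := exists_fin_val' (w := w) (v := (a : ℕ) + w) (by omega)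
    refine ⟨p, by omega, ?_, ?_⟩ <;> rw [skew_ne_zero_iff] <;> omega
  · obtain ⟨p, hp⟩ := exists_fin_val' (w := w) (v := (a : ℕ) - w) (by omega)
    refine ⟨p, by omega, ?_, ?_⟩ <;> rw [skew_ne_zero_iff] <;> omega

/-- **`T_{skewcw,2u}` is door-like for every `u ≥ 1`.**
[cite: ConnerGesmundoLandsbergVentura2022, §3.2] -/
noncomputable def doorLike_skewCwTensor (w : ℕ) (hw : 1 ≤ w) : DoorLike (skewCwTensor F w) := by
  have h0 : ((0 : Fin (2 * w + 1)) : ℕ) = 0 := rfl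
  let e₁ : Fin (2 * w + 1) := ⟨1, by omega⟩
  let e₂ : Fin (2 * w + 1) := ⟨2, by omega⟩
  have he₁ : (e₁ : ℕ) = 1 := rfl
  have he₂ : (e₂ : ℕ) = 2 := rfl
  refine ⟨fun b c i i' hi hi' => ?_, fun a c j j' hj hj' => ?_, fun a a' hne => ?_,
    fun b b' hne => ?_, fun a a' => ?_, fun b => ?_⟩
  · rw [skew_ne_zero_iff] at hi hi'
    exact Fin.ext (by omega)
  · rw [skew_ne_zero_iff] at hj hj'
    exact Fin.ext (by omega)
  · have hne' : (a : ℕ) ≠ a' := fun h => hne (Fin.ext h)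
    have halt := a.isLt
    have ha'lt := a'.isLt
    by_cases ha' : (a' : ℕ) = 0
    · by_cases ha1 : (a : ℕ) = 1
      · refine ⟨e₂, e₂, ?_, fun i => ?_⟩
        · rw [skew_ne_zero_iff]; omega
        · rw [skew_eq_zero_iff]; omega
      · refine ⟨e₁, e₁, ?_, fun i => ?_⟩
        · rw [skew_ne_zero_iff]; omega
        · rw [skew_eq_zero_iff]; omega
    · by_cases ha : (a : ℕ) = 0
      · obtain ⟨p, hp0, hp, -⟩ := exists_skewPartner (F := F) w a' ha'
        refine ⟨p, 0, hp, fun i => ?_⟩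
        rw [skew_eq_zero_iff]; omega
      · refine ⟨0, a', ?_, fun i => ?_⟩
        · rw [skew_ne_zero_iff]; omega
        · rw [skew_eq_zero_iff]; omega
  · have hne' : (b : ℕ) ≠ b' := fun h => hne (Fin.ext h)
    have hblt := b.isLt
    have hb'lt := b'.isLt
    by_cases hb' : (b' : ℕ) = 0
    · by_cases hb1 : (b : ℕ) = 1
      · refine ⟨e₂, e₂, ?_, fun i => ?_⟩
        · rw [skew_ne_zero_iff]; omega
        · rw [skew_eq_zero_iff]; omega
      · refine ⟨e₁, e₁, ?_, fun i => ?_⟩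
        · rw [skew_ne_zero_iff]; omega
        · rw [skew_eq_zero_iff]; omega
    · by_cases hb : (b : ℕ) = 0
      · obtain ⟨p, hp0, -, hp⟩ := exists_skewPartner (F := F) w b' hb'
        refine ⟨p, 0, hp, fun i => ?_⟩
        rw [skew_eq_zero_iff]; omega
      · refine ⟨0, b', ?_, fun i => ?_⟩
        · rw [skew_ne_zero_iff]; omega
        · rw [skew_eq_zero_iff]; omega
  · have halt := a.isLt
    have ha'lt := a'.isLt
    by_cases ha : (a : ℕ) = 0
    · by_cases ha' : (a' : ℕ) = 0
      · refine ⟨e₁, e₁, e₁, ?_, ?_⟩ <;> rw [skew_ne_zero_iff] <;> omega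
      · obtain ⟨p, hp0, hp, -⟩ := exists_skewPartner (F := F) w a' ha'
        exact ⟨p, p, 0, by rw [skew_ne_zero_iff]; omega, hp⟩
    · by_cases ha' : (a' : ℕ) = 0
      · obtain ⟨p, hp0, hp, -⟩ := exists_skewPartner (F := F) w a ha
        exact ⟨p, 0, p, hp, by rw [skew_ne_zero_iff]; omega⟩
      · refine ⟨0, a, a', ?_, ?_⟩ <;> rw [skew_ne_zero_iff] <;> omega
  · have hblt := b.isLt
    by_cases hb : (b : ℕ) = 0
    · exact ⟨e₁, e₁, by rw [skew_ne_zero_iff]; omega⟩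
    · exact ⟨0, b, by rw [skew_ne_zero_iff]; omega⟩

/-- `T_{skewcw,2u}` has third-leg data for every `u ≥ 1`.
[cite: ConnerGesmundoLandsbergVentura2022, §3.2] -/
noncomputable def thirdLeg_skewCwTensor (w : ℕ) (hw : 1 ≤ w) :
    ThirdLeg (skewCwTensor F w) := by
  have h0 : ((0 : Fin (2 * w + 1)) : ℕ) = 0 := rfl
  let e₁ : Fin (2 * w + 1) := ⟨1, by omega⟩
  let e : Fin (2 * w + 1) := ⟨1 + w, by omega⟩
  have he₁ : (e₁ : ℕ) = 1 := rfl
  have he : (e : ℕ) = 1 + w := rfl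
  refine ⟨fun c => ?_, fun a b k k' hk hk' => ?_⟩
  · have hclt := c.isLt
    by_cases hc : (c : ℕ) = 0
    · exact ⟨e₁, e, by rw [skew_ne_zero_iff]; omega⟩
    · exact ⟨0, c, by rw [skew_ne_zero_iff]; omega⟩
  · rw [skew_ne_zero_iff] at hk hk'
    exact Fin.ext (by omega)

/-! ## The converse door for the families -/

section Family

variable {K : Type u} [Field K]

/-- `k² = b^N` with `b ≥ 3`, `N ≥ 1` forces `k ≥ 2`. [folklore] -/
theorem two_le_of_sq_eq_pow {b k N : ℕ} (hb : 3 ≤ b) (hN : 1 ≤ N) (hk : k * k = b ^ N) :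
    2 ≤ k := by
  by_contra hlt
  have hk1 : k ≤ 1 := by omega
  have h3 : b ≤ b ^ N := by
    calc b = b ^ 1 := (pow_one b).symm
      _ ≤ b ^ N := Nat.pow_le_pow_right (by omega) hN
  have : k * k ≤ 1 := by nlinarith
  omega

/-- **The general format theorem** for a door-like `T₀` on `Fin b` with third-leg data: if
`⟨k,m,n⟩ ⊵ T₀^{⊠N}`, `N ≥ 1`, `b ≥ 3`, then `b^N ≤ kn, km, mn` and `b^{3N} < (kmn)²`.
[cite: ConnerGesmundoLandsbergVentura2022, §2.3] -/
theorem formats_pow_base {b : ℕ} (hb : 3 ≤ b) {T₀ : Fin b → Fin b → Fin b → K} (hT : DoorLike T₀)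
    (h3 : ThirdLeg T₀) (k m n N : ℕ) (hN : 1 ≤ N)
    (h : PolyDegeneratesTo (matMulTensor K k m n) (kroneckerPow T₀ N)) :
    b ^ N ≤ k * n ∧ b ^ N ≤ k * m ∧ b ^ N ≤ m * n ∧ b ^ (3 * N) < (k * m * n) ^ 2 := by
  obtain ⟨h1, h2, h3'⟩ :=
    formats_of_matMul_polyDegeneratesTo (hT.kroneckerPow N) (h3.kroneckerPow N) k m n h
  have hc : Fintype.card (Fin N → Fin b) = b ^ N := by simp
  rw [hc] at h1 h2 h3'
  refine ⟨h1, h2, h3', ?_⟩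
  have hle : (b ^ N) ^ 3 ≤ (k * m * n) ^ 2 := cube_le_sq_of_formats h1 h2 h3'
  rw [← pow_mul, Nat.mul_comm N 3] at hle
  rcases hle.lt_or_eq with hlt | heq
  · exact hlt
  · exfalso
    rw [Nat.mul_comm 3 N, pow_mul] at heq
    obtain ⟨hkm, hmn, hkk⟩ :=
      tight_of_formats (Nat.one_le_pow _ _ (by omega)) h1 h2 h3' heq.symm
    subst hkm
    subst hmn
    exact not_matMul_polyDegeneratesTo_of_doorLike (hT.kroneckerPow N) k
      (two_le_of_sq_eq_pow hb hN hkk) (by rw [hc]; exact hkk.symm) h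

/-- **`⟨m,m,m⟩ ⋭ T_{cw,q}^{⊠N}` whenever `q ≥ 2`, `m ≥ 2`, `m² = (q+1)^N`, over every field.**
[cite: ConnerGesmundoLandsbergVentura2022, §2.3] -/
theorem not_matMul_polyDegeneratesTo_cw_pow (q m N : ℕ) (hq : 2 ≤ q) (hm : 2 ≤ m)
    (hN : (q + 1) ^ N = m * m) :
    ¬ PolyDegeneratesTo (matMulTensor K m m m) (kroneckerPow (cwTensor K q) N) :=
  not_matMul_polyDegeneratesTo_of_doorLike ((doorLike_cwTensor q hq).kroneckerPow N) m hm
    (by rw [← hN]; simp)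

/-- **Theorem C for the whole family `T_{cw,q}`, every field**: `⟨k,m,n⟩ ⊵ T_{cw,q}^{⊠N}`
(`q ≥ 2`, `N ≥ 1`) forces `(q+1)^N ≤ kn, km, mn` and `(q+1)^{3N} < (kmn)²`.
[cite: ConnerGesmundoLandsbergVentura2022, §2.3] -/
theorem converseDoor_formats_cw (q k m n N : ℕ) (hq : 2 ≤ q) (hN : 1 ≤ N)
    (h : PolyDegeneratesTo (matMulTensor K k m n) (kroneckerPow (cwTensor K q) N)) :
    (q + 1) ^ N ≤ k * n ∧ (q + 1) ^ N ≤ k * m ∧ (q + 1) ^ N ≤ m * n ∧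
      (q + 1) ^ (3 * N) < (k * m * n) ^ 2 :=
  formats_pow_base (by omega) (doorLike_cwTensor q hq) (thirdLeg_cwTensor q (by omega))
    k m n N hN h

/-- **`⟨m,m,m⟩ ⋭ T_{skewcw,2u}^{⊠N}` whenever `u ≥ 1`, `m ≥ 2`, `m² = (2u+1)^N`, every field.**
[cite: ConnerGesmundoLandsbergVentura2022, §2.3] -/
theorem not_matMul_polyDegeneratesTo_skewCw_pow (w m N : ℕ) (hw : 1 ≤ w) (hm : 2 ≤ m)
    (hN : (2 * w + 1) ^ N = m * m) :
    ¬ PolyDegeneratesTo (matMulTensor K m m m) (kroneckerPow (skewCwTensor K w) N) :=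
  not_matMul_polyDegeneratesTo_of_doorLike ((doorLike_skewCwTensor w hw).kroneckerPow N) m hm
    (by rw [← hN]; simp)

/-- **Theorem C for the whole skew family `T_{skewcw,2u}`, every field.**
[cite: ConnerGesmundoLandsbergVentura2022, §2.3] -/
theorem converseDoor_formats_skewCw (w k m n N : ℕ) (hw : 1 ≤ w) (hN : 1 ≤ N)
    (h : PolyDegeneratesTo (matMulTensor K k m n) (kroneckerPow (skewCwTensor K w) N)) :
    (2 * w + 1) ^ N ≤ k * n ∧ (2 * w + 1) ^ N ≤ k * m ∧ (2 * w + 1) ^ N ≤ m * n ∧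
      (2 * w + 1) ^ (3 * N) < (k * m * n) ^ 2 :=
  formats_pow_base (by omega) (doorLike_skewCwTensor w hw) (thirdLeg_skewCwTensor w hw)
    k m n N hN h

end Family

end ConverseDoorCwFamily

end Summit.MatrixMultiplication.MatrixMultiplication.Theorems
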